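/-
Origin: expansion seat `planner-pub-hodgecm-mc-axioms-1-g14-0`, handover #W216 2026-08-20T15:53:55Z md5 f9f1ce1b621d (PKG 561d0700d2fc → f9f1ce1b621d; 125 l.; MECHANICAL (iib-R) rewrite v3.1 of the PKG file as it stands (46 token edits; rules R1x1+RX[h₂]x45)) (`HOME/mc/pub-hodgecm-mc-axioms-1-g14/revendor/kit-r55/stage55/HodgeCM/Model/Binders/Gen12OfSeesaw.lean`, md5 f9f1ce1b621d, 125 lines);
landed by the gen-22 packager (p-g22) in gate run 55 REPLACES the earlier landed copy of `HodgeCM/Model/Binders/Gen12OfSeesaw.lean` (seat copy carried the packager Origin header of an earlier run (stripped)).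
-/
/-
″ RE-CUT (adm) by prover-pub-hodgecm-mc-binder-1-g7-0, 2026-08-19: field `Gen12Residual.Adm` (admissibility predicate on
`K`-type situations, = `Gen12Junctions.Adm`); `SeesawHyp` is taken at `R.Adm`.
Origin: speedrun cell pub-hodgecm, MODEL-CONSTRUCTION sub-cell, unit pub-hodgecm-mc-binder-1-g6 (BINDER PROVER, gen 6; node
B2-meet, row 14 `gen12` ASSEMBLY after (J-seesaw)/(J-hW)), seat prover-pub-hodgecm-mc-binder-1-g6-0, 2026-08-19.
Target in PKG: HodgeCM/Model/Binders/Gen12OfSeesaw.lean (NEW additive leaf; imports `Model/Binders/MeetBridgesSeesaw` (kit #5) and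
`Model/Binders/GramWRegime` (kit #6); nothing landed imports it).  KERNEL ONLY: 0 records, nothing cited, MODEL-N 0.
-/
import Summits.HodgeConjecture.HodgeCM.Model.Binders.MeetBridgesSeesaw
import Summits.HodgeConjecture.HodgeCM.Model.Binders.GramWRegime

/-!
# E's binder `gen12` from the see-saw hypotheses and the RESIDUAL junctions (Sat, rep, proj)

`Binders/Gen12Junctions.gen12_of_junctions` reduces E's binder `gen12` to the record `Gen12Junctions = {Sat, rep, seesaw, proj}`;
`Binders/MeetBridgesSeesaw.seesaw_of_seesawHyp` discharges `seesaw` from `SeesawHyp = {τ, (SS), (SS-K), (hμ)}` under the regime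
`hW : IsAnisotropic L c.D.gramW`; `Binders/GramWRegime` proves `hW` at every good context.  This file assembles the three:

* `Gen12Residual hHD hI h₁ h₃ h hA W S μ V c hV` — the RESIDUAL junction record `{Adm, Sat, rep, proj}` (fields verbatim those of
  `Gen12Junctions`; owners: (J-sat)/(J-rep) = mc-theta-3's (Θ-sat) packet + CLASSMAP, (J-Λ) `proj` = emb lane / seat D-1′);
* `Gen12Residual.junctions` — `Gen12Residual` + `SeesawHyp` ⇒ `Gen12Junctions` at a good sextic context;
* **`gen12_of_seesaw`** — E's binder `gen12` IN ITS QUANTIFIED FORM (verbatim) from, per good sextic context (regime `hV` supplied,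
  regime of `U(W)` DERIVED), one `Gen12Residual` and one `SeesawHyp`.  No hypothesis beyond these two records and E's own guards.
-/

set_option autoImplicit false

noncomputable section

open MeasureTheory NumberField
open scoped InnerProductSpace

namespace HodgeCM.Model

open HodgeCM HodgeCM.Universe
open Literature.NumberTheory.Automorphic.WeightForms (ClassMapDatum thetaClasses restrictHom IsLevelCorrected IsWeightMatched)
open Literature.AlgebraicGeometry.HodgeTheory
open Literature.NumberTheory.Automorphic.PicardCM
open Literature.NumberTheory.Transcendental (Arapura2012_Cor_15_4_6)
open HodgeCM.Model.ThetaSpace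

variable (hHD : exists_isReal_hodgeModel) (hI : hodgePQ_independent_of_hodgeModel)
  (h₁ : BallQuotientUniformised)  (h₃ : CMAbelianVarietyRealised)
variable (h : Bool) (hA : Arapura2012_Cor_15_4_6)
  (W : ∀ {L : CMField} {ι₁ : L →+* ℂ} (V : HermSpace3 L ι₁) (c : SeesawCtx L), WmInput V c.D)
  (S : ∀ {L : CMField} {ι₁ : L →+* ℂ} (V : HermSpace3 L ι₁) (c : SeesawCtx L), ThetaAdelicSide V c)
  (μ : ∀ {L : CMField}, SeesawCtx L → Fin 4 → InfinitePlace L → ℤ)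
variable {L : CMField} {ι₁ : L →+* ℂ} (V : HermSpace3 L ι₁) (c : SeesawCtx L) (hV : IsAnisotropic L V.Hm)

/-- **The RESIDUAL junctions of row `gen12`** after (J-seesaw): the saturation predicate, the admissible representatives of theta
one-forms in the span of the generating theta forms, and the piece projection — the fields `Sat`, `rep`, `proj` of `Gen12Junctions`,
verbatim.  A HYPOTHESIS record. -/
structure Gen12Residual where
  /-- (J-adm) the ADMISSIBILITY predicate on `K`-type situations whose theta forms generate (at the (Θ-sat) pin: saturated at the
  level's compact open AND strict) -/
  Adm : ∀ (Γ : Level V) (k : Fin 4),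
    KTypeSituation ((pinX hHD hI h₁ h₃ S V c hV).P k) ((pinX hHD hI h₁ h₃ S V c hV).ιinf Γ)
      ((pinX hHD hI h₁ h₃ S V c hV).Δ Γ) (pinX hHD hI h₁ h₃ S V c hV).κ₁ (pinX hHD hI h₁ h₃ S V c hV).τ₁ → Prop
  /-- (J-sat) the saturation predicate on adelic representatives, per level -/
  Sat : Level V → (quotU V).leftInvCont₂ → Prop
  /-- (J-rep) admissible adelic representatives of theta one-forms of types `0`, `1` -/
  rep : ∀ (Γ : Level V) (k : Fin 4), k = 0 ∨ k = 1 →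
    ∀ ω ∈ (pinT hHD hI h₁ h₃ h hA W S μ).Theta V c k Γ,
      ∃ (cl : ((pinX hHD hI h₁ h₃ S V c hV).D Γ).H10) (G : (quotU V).leftInvCont₂),
        (cl : (picardCMUniverse hHD hI h₁ h₃).CohC ((picardCMUniverse hHD hI h₁ h₃).pms L ι₁ V Γ) 1) = ω ∧
        G ∈ Submodule.span ℂ (thetaGen hHD hI h₁ h₃ S V c hV Γ k (Adm Γ k)) ∧ Sat Γ G ∧
        ((((pinX hHD hI h₁ h₃ S V c hV).D Γ).pull cl).1 : (pinX hHD hI h₁ h₃ S V c hV).G₁ → (Fin 2 → ℂ)) =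
          (G : (quotU V).G → (Fin 2 → ℂ)) ∘ ((pinX hHD hI h₁ h₃ S V c hV).ιinf Γ)
  /-- (J-Λ) PIECE PROJECTION for saturated representatives -/
  proj : ∀ (Γ : Level V) (cl₁ cl₂ : ((pinX hHD hI h₁ h₃ S V c hV).D Γ).H10) (G₁ G₂ : (quotU V).leftInvCont₂),
    Sat Γ G₁ → Sat Γ G₂ →
    ((((pinX hHD hI h₁ h₃ S V c hV).D Γ).pull cl₁).1 : (pinX hHD hI h₁ h₃ S V c hV).G₁ → (Fin 2 → ℂ)) =
      (G₁ : (quotU V).G → (Fin 2 → ℂ)) ∘ ((pinX hHD hI h₁ h₃ S V c hV).ιinf Γ) →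
    ((((pinX hHD hI h₁ h₃ S V c hV).D Γ).pull cl₂).1 : (pinX hHD hI h₁ h₃ S V c hV).G₁ → (Fin 2 → ℂ)) =
      (G₂ : (quotU V).G → (Fin 2 → ℂ)) ∘ ((pinX hHD hI h₁ h₃ S V c hV).ιinf Γ) →
    ∃ (a : ℂ) (p : (pinT hHD hI h₁ h₃ h hA W S μ).HG L ι₁ V), a ≠ 0 ∧
      (pinT hHD hI h₁ h₃ h hA W S μ).Λ Γ
          (cl₁ : (picardCMUniverse hHD hI h₁ h₃).CohC ((picardCMUniverse hHD hI h₁ h₃).pms L ι₁ V Γ) 1)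
          (cl₂ : (picardCMUniverse hHD hI h₁ h₃).CohC ((picardCMUniverse hHD hI h₁ h₃).pms L ι₁ V Γ) 1) = a • p ∧
      ⟪p, (quotU V).realise ((quotU V).wedge₂ G₁ G₂)⟫_ℂ = ⟪p, p⟫_ℂ

namespace Gen12Residual

variable {hHD hI h₁ h₃ h hA W S μ V c hV}

/-- **`Gen12Residual` + `SeesawHyp` ⇒ `Gen12Junctions`** in the regime of `U(W)`. -/
def junctionsOfRegime (R : Gen12Residual hHD hI h₁ h₃ h hA W S μ V c hV) (hW : IsAnisotropic L c.D.gramW)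
    (H : SeesawHyp hHD hI h₁ h₃ W S μ V c hV R.Adm) : Gen12Junctions hHD hI h₁ h₃ h hA W S μ V c hV where
  Adm := R.Adm
  Sat := R.Sat
  rep := R.rep
  seesaw := seesaw_of_seesawHyp hHD hI h₁ h₃ h hA W S μ V c hV R.Adm hW H
  proj := R.proj

/-- **`Gen12Residual` + `SeesawHyp` ⇒ `Gen12Junctions` at a GOOD context** (the regime of `U(W)` is derived: `GramWRegime`). -/
def junctions (R : Gen12Residual hHD hI h₁ h₃ h hA W S μ V c hV) (H : SeesawHyp hHD hI h₁ h₃ W S μ V c hV R.Adm)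
    (hc : (pinT hHD hI h₁ h₃ h hA W S μ).GoodCtx ι₁ c) : Gen12Junctions hHD hI h₁ h₃ h hA W S μ V c hV :=
  R.junctionsOfRegime
    ((pinC hHD hI h₁ h₃ hA W S).isAnisotropic_gramW_of_goodCtx h (d12Of μ) (d34Of μ)
      ((pinT_eq_thetaModel hHD hI h₁ h₃ h hA W S μ) ▸ hc)) H

end Gen12Residual

/-- **E's binder `gen12` (verbatim, quantified form) from the RESIDUAL junctions and the see-saw hypotheses** at every good sextic
context — the regimes of `U(V)` and `U(W)` both DERIVED from the context (`isAnisotropic_of_goodCtx`, `isAnisotropic_gramW_of_goodCtx`). -/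
theorem gen12_of_seesaw
    (R : ∀ {L : CMField} {ι₁ : L →+* ℂ} (V : HermSpace3 L ι₁) (c : SeesawCtx L) (hV : IsAnisotropic L V.Hm),
      (pinT hHD hI h₁ h₃ h hA W S μ).GoodCtx ι₁ c → Module.finrank ℚ c.K = 6 →
        Gen12Residual hHD hI h₁ h₃ h hA W S μ V c hV)
    (H : ∀ {L : CMField} {ι₁ : L →+* ℂ} (V : HermSpace3 L ι₁) (c : SeesawCtx L) (hV : IsAnisotropic L V.Hm)
      (hc : (pinT hHD hI h₁ h₃ h hA W S μ).GoodCtx ι₁ c) (hK : Module.finrank ℚ c.K = 6),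
        SeesawHyp hHD hI h₁ h₃ W S μ V c hV (R V c hV hc hK).Adm)
    {L : CMField} {ι₁ : L →+* ℂ} (V : HermSpace3 L ι₁) (c : SeesawCtx L)
    (hc : (pinT hHD hI h₁ h₃ h hA W S μ).GoodCtx ι₁ c) (hK : Module.finrank ℚ c.K = 6) :
    Nonempty ((pinT hHD hI h₁ h₃ h hA W S μ).Gen12FunBridge V c) :=
  gen12_of_junctions hHD hI h₁ h₃ h hA W S μ
    (fun V c hV hc hK => (R V c hV hc hK).junctions (H V c hV hc hK) hc) V c hc hK

end HodgeCM.Model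

end
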